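import Summits.Parity.GeneralizedHardyLittlewood.Theorems.PrimeLevelFamEdgeMomentsBeyondDiagonalDiagCornerAbelRayCross
import HarnessLib

/-!
# Route `PrimeLevelFamEdge`, crux K_A `MomentsBeyondDiagonal` (stmt-Parity-20007), line «petersson_layers» v4, stub `stub_diag`:
# **ray variation with a `log M` bound (uniform in the ray length)**

`…DiagCornerAbelRay` / `…DiagCornerAbelRayCross` bound the `[1,M]` part of the ray variation by `K(1+log w)`, `w` the ray length.
The abstract two-variable estimate `…DiagCornerAbelBVTwoVar.abs_doubleSum_bv_pow_le` asks for a ray-variation constant `V`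
uniform over all rays with `c(w+1) ≤ M = 2αY²`; since on the `[1,M]` piece the indices satisfy `e+1 ≥ 1/c`, the harmonic sum is
in fact `≤ 1 + log M`. This file records that refinement:

* `sum_Ioc_inv_le_log` — `Σ_{p<e≤q} 1/e ≤ 1 + log(q/(p+1))` (`p < q`);
* `sum_abs_sub_le_of_lipschitz_inv_log` — `[1,M]`-rays: variation `≤ K(1 + |log M|)`;
* `sum_abs_sub_ray_le_log` — across `y = 1`: variation `≤ 2C_s + 2G + K(1 + |log M|)`, uniformly in the ray.

Def-free; theorems only. Helper `--supports stmt-Parity-20007`; closes nothing; K_A, K_B and the Parity summit are NOT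
proved; nothing about Landau–Siegel zeros.

## References
* E. Kowalski, P. Michel, J. VanderKam, J. reine angew. Math. 526 (2000), Prop. 5.1 p. 18.
  [cite: KowalskiMichelVanderKam2000, Prop. 5.1 — derivation (summation by parts in the corner of the diagonal)]
-/

noncomputable section

open Finset Real

namespace Summit.Parity.GeneralizedHardyLittlewood.Theorems.MomentsBeyondDiagonal.DiagCorner

open Summit.Parity.GeneralizedHardyLittlewood.Theorems.BeyondDiagonalBeatsQuarter.KernelFormXSq (sum_Ioc_sub_succ)

/-- `Σ_{p<e≤q} 1/e ≤ 1 + log(q/(p+1))` for `p < q` (`1/e ≤ log e − log(e−1)` for `e ≥ 2`). [folklore] -/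
theorem sum_Ioc_inv_le_log {p q : ℕ} (hpq : p < q) :
    ∑ e ∈ Ioc p q, (1 : ℝ) / e ≤ 1 + Real.log ((q : ℝ) / ((p : ℝ) + 1)) := by
  have hp1 : (0 : ℝ) < (p : ℝ) + 1 := by positivity
  have hq0 : (0 : ℝ) < q := by exact_mod_cast (show 0 < q by omega)
  -- split off the first term `e = p + 1`
  rw [← Finset.sum_Ioc_consecutive _ (Nat.le_succ p) (show p + 1 ≤ q by omega), Nat.Ioc_succ_singleton, Finset.sum_singleton]
  have hfirst : (1 : ℝ) / ((p + 1 : ℕ) : ℝ) ≤ 1 := by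
    rw [div_le_one (by positivity)]; exact_mod_cast Nat.succ_le_succ (Nat.zero_le p)
  -- the tail telescopes against `log`
  have htail : ∑ e ∈ Ioc (p + 1) q, (1 : ℝ) / e ≤ Real.log q - Real.log ((p : ℝ) + 1) := by
    rcases eq_or_lt_of_le (show p + 1 ≤ q by omega) with h | h
    · rw [← h, Finset.Ioc_self, Finset.sum_empty]; push_cast; linarith
    have hterm : ∀ e ∈ Ioc (p + 1) q, (1 : ℝ) / e ≤ -Real.log ((e : ℝ) - 1) - -Real.log (((e + 1 : ℕ) : ℝ) - 1) := by
      intro e he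
      have he' := Finset.mem_Ioc.1 he
      have he2 : (2 : ℝ) ≤ e := by exact_mod_cast (show 2 ≤ e by omega)
      have he0 : (0 : ℝ) < e := by linarith
      have he1 : (0 : ℝ) < (e : ℝ) - 1 := by linarith
      push_cast
      rw [add_sub_cancel_right]
      -- `log((e-1)/e) ≤ (e-1)/e - 1 = -1/e`
      have h := Real.log_le_sub_one_of_pos (div_pos he1 he0)
      rw [Real.log_div he1.ne' he0.ne'] at h
      have : ((e : ℝ) - 1) / e - 1 = -(1 / e) := by field_simp; ring
      linarith
    refine (Finset.sum_le_sum hterm).trans ?_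
    rw [sum_Ioc_sub_succ (fun e : ℕ ↦ -Real.log ((e : ℝ) - 1)) h.le]
    push_cast
    ring_nf
    rfl
  rw [Real.log_div hq0.ne' hp1.ne']
  linarith

/-- **`[1,M]`-ray variation, uniform in the length.** If `|r(y₁)−r(y₂)| ≤ K(y₂−y₁)/y₁` for `1 ≤ y₁ ≤ y₂ ≤ M` (`K ≥ 0`), then for
`c > 0`, `1 ≤ c(u+1)`, `c(w+1) ≤ M`: `Σ_{u<e≤w}|r(c(e+1)) − r(ce)| ≤ K(1 + |log M|)`. [folklore] -/
theorem sum_abs_sub_le_of_lipschitz_inv_log {r : ℝ → ℝ} {K c M : ℝ} (hK : 0 ≤ K) (hc : 0 < c)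
    (hr : ∀ y₁ y₂ : ℝ, 1 ≤ y₁ → y₁ ≤ y₂ → y₂ ≤ M → |r y₁ - r y₂| ≤ K * (y₂ - y₁) / y₁)
    {u w : ℕ} (hu : 1 ≤ c * ((u : ℝ) + 1)) (hw : c * ((w : ℝ) + 1) ≤ M) :
    ∑ e ∈ Ioc u w, |r (c * ((e : ℝ) + 1)) - r (c * e)| ≤ K * (1 + |Real.log M|) := by
  rcases le_or_gt w u with hwu | hwu
  · rw [Finset.Ioc_eq_empty (by omega), Finset.sum_empty]
    positivity
  have hterm : ∀ e ∈ Ioc u w, |r (c * ((e : ℝ) + 1)) - r (c * e)| ≤ K * ((1 : ℝ) / e) := by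
    intro e he
    have he' := Finset.mem_Ioc.1 he
    have heu : (u : ℝ) + 1 ≤ e := by exact_mod_cast (show u + 1 ≤ e by omega)
    have hew : (e : ℝ) + 1 ≤ (w : ℝ) + 1 := by exact_mod_cast (show e + 1 ≤ w + 1 by omega)
    have he0 : (0 : ℝ) < e := by exact_mod_cast (show 0 < e by omega)
    have hy1 : 1 ≤ c * (e : ℝ) := hu.trans (by nlinarith)
    have hy12 : c * (e : ℝ) ≤ c * ((e : ℝ) + 1) := by nlinarith
    have hy2 : c * ((e : ℝ) + 1) ≤ M := (by nlinarith : c * ((e : ℝ) + 1) ≤ c * ((w : ℝ) + 1)).trans hw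
    have h := hr (c * e) (c * ((e : ℝ) + 1)) hy1 hy12 hy2
    rw [abs_sub_comm] at h
    refine h.trans (le_of_eq ?_)
    field_simp
    ring
  have hsum := sum_Ioc_inv_le_log hwu
  -- `w/(u+1) ≤ M`: from `c(w+1) ≤ M` and `c(u+1) ≥ 1`
  have hu1 : (0 : ℝ) < (u : ℝ) + 1 := by positivity
  have hratio : (w : ℝ) / ((u : ℝ) + 1) ≤ M := by
    rw [div_le_iff₀ hu1]
    have h1 : (w : ℝ) ≤ c * ((w : ℝ) + 1) * ((u : ℝ) + 1) := by nlinarith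
    nlinarith
  have hM0 : 0 < M := by
    have : (0 : ℝ) < c * ((w : ℝ) + 1) := by positivity
    linarith [hw]
  have hw0 : (0 : ℝ) < (w : ℝ) / ((u : ℝ) + 1) := div_pos (by exact_mod_cast (show 0 < w by omega)) hu1
  have hlog : Real.log ((w : ℝ) / ((u : ℝ) + 1)) ≤ Real.log M := Real.log_le_log hw0 hratio
  calc ∑ e ∈ Ioc u w, |r (c * ((e : ℝ) + 1)) - r (c * e)| ≤ ∑ e ∈ Ioc u w, K * ((1 : ℝ) / e) :=
        Finset.sum_le_sum hterm
    _ = K * ∑ e ∈ Ioc u w, (1 : ℝ) / e := by rw [Finset.mul_sum]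
    _ ≤ K * (1 + Real.log ((w : ℝ) / ((u : ℝ) + 1))) := mul_le_mul_of_nonneg_left hsum hK
    _ ≤ K * (1 + |Real.log M|) := by gcongr; exact hlog.trans (le_abs_self _)

/-- **Ray variation across `y = 1`, uniform in the ray.** Let `c > 0`, `u ≤ w`, `c(w+1) ≤ M`; suppose
`|r(y₁)−r(y₂)| ≤ C_s(y₂−y₁)/√y₁` for `0<y₁≤y₂≤1`, `|r(y₁)−r(y₂)| ≤ K(y₂−y₁)/y₁` for `1≤y₁≤y₂≤M` (`K ≥ 0`) and `|r(y)| ≤ G` for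
`0 < y ≤ M`. Then `Σ_{u<e≤w}|r(c(e+1)) − r(ce)| ≤ 2C_s + 2G + K(1+|log M|)`. [folklore] -/
theorem sum_abs_sub_ray_le_log {r : ℝ → ℝ} {Cs K G M c : ℝ} (hc : 0 < c) (hK : 0 ≤ K)
    (hS : ∀ y₁ y₂ : ℝ, 0 < y₁ → y₁ ≤ y₂ → y₂ ≤ 1 → |r y₁ - r y₂| ≤ Cs * (y₂ - y₁) / Real.sqrt y₁)
    (hT : ∀ y₁ y₂ : ℝ, 1 ≤ y₁ → y₁ ≤ y₂ → y₂ ≤ M → |r y₁ - r y₂| ≤ K * (y₂ - y₁) / y₁)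
    (hG : ∀ y : ℝ, 0 < y → y ≤ M → |r y| ≤ G)
    {u w : ℕ} (huw : u ≤ w) (hw : c * ((w : ℝ) + 1) ≤ M) :
    ∑ e ∈ Ioc u w, |r (c * ((e : ℝ) + 1)) - r (c * e)| ≤ 2 * Cs + 2 * G + K * (1 + |Real.log M|) := by
  -- identical to `sum_abs_sub_ray_le` except that the `[1,M]` piece uses `sum_abs_sub_le_of_lipschitz_inv_log`
  have hG0 : 0 ≤ G := (abs_nonneg _).trans (hG (c * ((w : ℝ) + 1)) (by positivity) hw)
  have hCs0 : 0 ≤ Cs := by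
    have h1 := hS (1 / 4) (1 / 2) (by norm_num) (by norm_num) (by norm_num)
    have h2 : 0 ≤ Cs * (1 / 2 - 1 / 4) / Real.sqrt (1 / 4) := (abs_nonneg _).trans h1
    have hq : (0 : ℝ) < (1 / 2 - 1 / 4) / Real.sqrt (1 / 4) := by positivity
    rw [mul_div_assoc] at h2
    exact nonneg_of_mul_nonneg_left h2 hq
  set F : ℕ → ℝ := fun e ↦ |r (c * ((e : ℝ) + 1)) - r (c * e)| with hF
  have hstep : ∀ e ∈ Ioc u w, F e ≤ 2 * G := by
    intro e he
    have he' := Finset.mem_Ioc.1 he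
    have he0 : (0 : ℝ) < e := by exact_mod_cast (show 0 < e by omega)
    have hew : (e : ℝ) + 1 ≤ (w : ℝ) + 1 := by exact_mod_cast (show e + 1 ≤ w + 1 by omega)
    have h1 := hG (c * ((e : ℝ) + 1)) (by positivity) ((by nlinarith : c * ((e : ℝ) + 1) ≤ c * ((w : ℝ) + 1)).trans hw)
    have h2 := hG (c * e) (by positivity) ((by nlinarith : c * (e : ℝ) ≤ c * ((w : ℝ) + 1)).trans hw)
    calc F e ≤ |r (c * ((e : ℝ) + 1))| + |r (c * e)| := abs_sub _ _
      _ ≤ G + G := add_le_add h1 h2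
      _ = 2 * G := by ring
  set m₁ : ℕ := ⌊1 / c⌋₊ with hm₁
  have hm₁le : c * (m₁ : ℝ) ≤ 1 := by
    have h := Nat.floor_le (show (0 : ℝ) ≤ 1 / c by positivity)
    rw [← hm₁] at h
    calc c * (m₁ : ℝ) ≤ c * (1 / c) := by gcongr
      _ = 1 := by field_simp
  have hm₁lt : 1 < c * ((m₁ : ℝ) + 1) := by
    have h := Nat.lt_floor_add_one (1 / c)
    rw [← hm₁] at h
    calc (1 : ℝ) = c * (1 / c) := by field_simp
      _ < c * ((m₁ : ℝ) + 1) := by gcongr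
  set s₁ : ℕ := max u (min w (m₁ - 1)) with hs₁
  set s₂ : ℕ := max u (min w m₁) with hs₂
  have hus₁ : u ≤ s₁ := le_max_left _ _
  have hs₁₂ : s₁ ≤ s₂ := by
    rw [hs₁, hs₂]; exact max_le_max le_rfl (min_le_min le_rfl (Nat.sub_le _ _))
  have hs₂w : s₂ ≤ w := max_le huw (min_le_left _ _)
  have hsplit : ∑ e ∈ Ioc u w, F e = (∑ e ∈ Ioc u s₁, F e) + (∑ e ∈ Ioc s₁ s₂, F e) + ∑ e ∈ Ioc s₂ w, F e := by
    rw [Finset.sum_Ioc_consecutive F hus₁ hs₁₂, Finset.sum_Ioc_consecutive F (hus₁.trans hs₁₂) hs₂w]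
  have hpiece1 : ∑ e ∈ Ioc u s₁, F e ≤ 2 * Cs := by
    rcases eq_or_lt_of_le hus₁ with h | h
    · rw [← h, Finset.Ioc_self, Finset.sum_empty]; linarith
    · have hs₁' : s₁ = min w (m₁ - 1) := by
        rw [hs₁]; exact max_eq_right (le_of_lt (by rw [hs₁] at h; exact lt_max_iff.1 h |>.resolve_left (lt_irrefl _)))
      have hs₁m : s₁ + 1 ≤ m₁ := by
        have : s₁ ≤ m₁ - 1 := hs₁' ▸ min_le_right _ _
        omega
      have hcw : c * ((s₁ : ℝ) + 1) ≤ 1 := by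
        have : (s₁ : ℝ) + 1 ≤ m₁ := by exact_mod_cast hs₁m
        calc c * ((s₁ : ℝ) + 1) ≤ c * m₁ := by gcongr
          _ ≤ 1 := hm₁le
      have hray := sum_abs_sub_le_of_lipschitz_sqrt (r := r) (C := Cs) hc hS h.le hcw
      have hsq1 : Real.sqrt (c * ((s₁ : ℝ) + 1)) ≤ 1 := Real.sqrt_le_one.2 hcw
      calc ∑ e ∈ Ioc u s₁, F e ≤ 2 * Cs * Real.sqrt (c * ((s₁ : ℝ) + 1)) := hray
        _ ≤ 2 * Cs * 1 := by gcongr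
        _ = 2 * Cs := mul_one _
  have hpiece2 : ∑ e ∈ Ioc s₁ s₂, F e ≤ 2 * G := by
    have hcard : (Ioc s₁ s₂).card ≤ 1 := by
      rw [Nat.card_Ioc, hs₁, hs₂]; omega
    calc ∑ e ∈ Ioc s₁ s₂, F e ≤ ∑ e ∈ Ioc s₁ s₂, 2 * G :=
          Finset.sum_le_sum fun e he ↦ hstep e (Finset.Ioc_subset_Ioc hus₁ hs₂w he)
      _ = (Ioc s₁ s₂).card * (2 * G) := by rw [Finset.sum_const, nsmul_eq_mul]
      _ ≤ 1 * (2 * G) := by gcongr; exact_mod_cast hcard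
      _ = 2 * G := one_mul _
  have hpiece3 : ∑ e ∈ Ioc s₂ w, F e ≤ K * (1 + |Real.log M|) := by
    rcases eq_or_lt_of_le hs₂w with h | h
    · rw [h, Finset.Ioc_self, Finset.sum_empty]; positivity
    · have hs₂' : m₁ ≤ s₂ := by
        have : min w m₁ = m₁ := by
          rw [min_eq_right_iff]
          by_contra hlt
          rw [not_le] at hlt
          have : s₂ = max u w := by rw [hs₂, min_eq_left hlt.le]
          rw [this] at h
          exact absurd h (not_lt.2 (le_max_right _ _))
        rw [hs₂, this]; exact le_max_right _ _
      have hu' : 1 ≤ c * ((s₂ : ℝ) + 1) := by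
        have : (m₁ : ℝ) + 1 ≤ (s₂ : ℝ) + 1 := by exact_mod_cast Nat.succ_le_succ hs₂'
        exact hm₁lt.le.trans (by nlinarith)
      exact sum_abs_sub_le_of_lipschitz_inv_log (r := r) hK hc hT hu' hw
  rw [hsplit]
  linarith [hpiece1, hpiece2, hpiece3]

end Summit.Parity.GeneralizedHardyLittlewood.Theorems.MomentsBeyondDiagonal.DiagCorner

end
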